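import Literature.NumberTheory.LFunctions.GreatestRealZeroElementarySmallLOneProofs
import Literature.NumberTheory.LFunctions.RealZeroEffectiveRepulsionOdd
import HarnessLib

/-!
# Pintz 1976 (II), Lemma 3 — `L(1) > (1/(5 log D))(α log A/(8 log D))^{8 log D/log A}` for
# `D ≥ 1500` — PROVED AS PRINTED

Topic `Literature/NumberTheory/LFunctions` (namespace `Literature.NumberTheory.LFunctions`, helpers
in `Pintz1976`). Third PROOF file for the statement file `GreatestRealZeroElementary.lean` (cell
`parity-realchar`, SIEGEL INSTRUMENT conditionals column, topic I.18 «prime splitting in the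
exceptional field»; cc `landau-siegel` §C), after `GreatestRealZeroElementaryProofs.lean`
(Theorems 1–2) and `GreatestRealZeroElementarySmallLOneProofs.lean` (Theorems 4–5 and Lemma 3 in
THRESHOLD form, `Pintz1976.lemma3_weak`: `D ≥ 65536`, constants `16`, `16`, `9`). Discharged here:

* `pintz1976_lemma3_holds : pintz1976_lemma3` — J. Pintz, *Elementary methods in the theory of
  L-functions, II*, Acta Arith. **31** (1976) 273–289, Lemma 3 p. 286 (5.1)–(5.2), WITH THE PRINTED
  CONSTANTS: "For a non-principal real character `χ (mod D)` (`≥ 1500`) for any `A`, `2 ≤ A ≤ D²`,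
  and with the notation `Σ_{A<p≤D², χ(p)≠−1} 1/p = α` the inequality
  `L(1) > (1/(5 log D))(α log A/(8 log D))^{8 log D/log A}` holds" (typed for primitive real `χ`).

Everything in this file is PROVED (theorems only; no definition, no named fact, no new hypothesis).

## Source and road (as printed, §5 pp. 286–287; scan pages under
`run/shared/lean/pub/parity-realchar/littype-FP2-2/scans-g11/PintzII-p286.png`, `-p287.png`, READ)

PRINT (p. 286): "Proof. Let us consider all the intervals of the form `(A^{2^{i−1}}, A^{2^i}]` for
`i = 1, 2, …, m`, where `m` is defined by `C = A^{2^{m−1}} < D⁴ ≤ A^{2^m} = C²`. As here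
`A^{2^m} = C² < D⁸`, we have `2^m < 8 log D/log A`. Then there exists an `i ≤ m` for which
`Σ_{A^{2^{i−1}}<p≤A^{2^i}, χ(p)≠−1} 1/p ≥ α/m`. If we raise the two sides of this inequality to the
power `2^{m−i}` then on the left side we shall get numbers of the form `n^{−1}`,
`n = ∏_{j=1}^{2^{m−i}} p_j` (`A^{2^{i−1}} < p ≤ A^{2^i}`; `χ(p) ≠ −1`) with a multiplicity `≤ 2^{m−i}!`,
so we have (since `α < m`) `Σ_{C<n≤C², p∣n⇒χ(p)≠−1} 1/n ≥ (1/2^{m−i}!)(α/m)^{2^{m−i}} > (α/2^m)^{2^m}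
> (α log A/(8 log D))^{8 log D/log A}`. Considering that if for all `p` prime factors of `n`
`χ(p) ≠ −1`, then `g(n) ≥ 1`, and that for an arbitrary `m`, `g(m) ≥ 0`, we get (5.3)
`Σ_{C<n≤C²} g(n)/n > (α log A/(8 log D))^{8 log D/log A}`." (p. 287): "But our Lemma 1 asserts for
`x ≥ √D log²D` `Σ_{n≤x} g(n)/n = L′(1) + (log x + c)L(1) + 5ϑ√(√D log D log x/x)`. Applying this
with `x = C`, and `x = C²`, we have as `D² ≤ C < D⁴`, `√D·L(1) ≥ π`, (5.4)
`Σ_{C<n≤C²} g(n)/n = log C·L(1) + 10ϑ√(√D log D log D⁴/D²) ≤ 4 log D·L(1) + 20 log D/D^{3/4}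
< 5 log D·L(1)`. (5.4) and (5.3) together gives (5.2)."

HERE (`Pintz1976.lemma3`), the same architecture with `C = A^K`, `K = 2^{m−1}`, `2L ≤ K log A < 4L`
(`L = log D`), on the sibling file's engines — `pow_sum_inv_le_factorial_mul_sum` (multiplicity
`≤ (2^{m−i})!`), `one_le_g_of_forall_primeFactors` (`g ≥ 1`), the selection inequality
`rpow_div_le_of_pow_le_factorial_mul` (which replaces the printed "(since `α < m`)" and needs
`α ≤ 8 log D/log A`), `sum_Ioc_g_div_le` (Montgomery–Vaughan 11.2.3(g) twice, the tree's substitute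
for Lemma 1) — with three additions that give the PRINTED constants:
* `sum_inv_primes_le_exponent`: the selection hypothesis `α ≤ 8 log D/log A` holds for EVERY
  `2 ≤ A ≤ D²`, `D ≥ 1500`, by Mertens' theorem with rate (`Mertens.abs_primeRecipSum_sub_le`) at
  `D²` and at `A`: `α ≤ log(M/4) + 4/L + M/L ≤ M` (`M = 8L/log A ≥ 4`, `L ≥ 7`);
* `mv_error_opt`: Exercise 11.2.3(g) with the OPTIMISED cut `Y = ⌊√(WN)/2⌋`, `W = 8√D(1+L)(log N+1)`,
  error `≤ 4√(W/N)` (the sibling's `Y = ⌊√N⌋` loses a factor `D^{1/4}` and forces `C ≥ D⁴`); at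
  `N₁ = ⌊C⌋ ≥ D²`, `N₂ = ⌊C²⌋ ≥ D⁴` the two errors total `≤ 11.32 D^{1/4}(2L + 1.25)/D ≤ (L − 0.7)π/√D`
  once `D ≥ 12000` (`err_total_le`), while the main term is `< (4L + 0.7)L(1)` (`⌊C⌋ ≥ C/2`,
  `log 2 < 0.7`) and `√D·L(1) ≥ π` (`pi_div_sqrt_le_lOne_re`: odd — class number formula; even —
  `√D·L(1) ≥ log(D − 4) ≥ 7`), so that `Σ_{C<n≤C²} g(n)/n < 5L·L(1)` exactly as in (5.4);
* for `1500 ≤ D < 12000` no counting is needed: `α ≤ 8L/log A` makes the power `≤ 1`, and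
  `1/(5L) < π/√D ≤ L(1)` (`√D < 109.55 < 35π`).

READING NOTES. (i) The printed "(since `α < m`)" would need `Σ_{y<p≤y²} 1/p < 1` uniformly; the
selection inequality (sibling file) uses `α ≤ 8 log D/log A` instead, which is proved here, so the
lemma holds with no extra hypothesis. (ii) Pintz's own (5.4) needs `20 log D/D^{3/4} < log D·L(1)`,
i.e. `D^{1/4} > 20/π` (`D > 1644`) by his constants; the typed threshold `1500` is nevertheless
correct, the small moduli being covered directly as above. (iii) Lemma 1 of part II (printed
constant `5`, see the statement file's note on `pintz1976_lemma1`) is NOT used. WHAT THIS IS NOT: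
nothing here bears on parity; no claim about the existence of characters with small `L(1)`.

## References

* [Pintz1976ElementaryII] J. Pintz, Acta Arith. 31 (1976) 273–289: Lemma 3 p. 286 (5.1)–(5.2),
  proof pp. 286–287 (5.3)–(5.4).
* [MontgomeryVaughan2007] §11.2.1 Exercise 3(g) (tree `DirichletConvOneChiSum.lean`,
  `GreatestRealZeroElementaryProofs.lean`); Theorem 9.13 (class number formula bounds, tree
  `RealZeroEffectiveRepulsionOdd/Even.lean`, `ConreyIwaniec2002LOneTrivialLowerBound.lean`).
* [HardyWright2008] Thm 427 (Mertens' second theorem with rate; tree `MertensFormula.lean`).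
-/

noncomputable section

open Complex Finset

namespace Literature.NumberTheory.LFunctions

namespace Pintz1976

open DirichletAbel RealChar Literature.NumberTheory.LFunctions.Mertens
open scoped Nat

section Helpers

/-- Products of `k ≥ 1` naturals from `(y, y²]` lie in `(y^k, y^{2k}]` (`y > 0`). [folklore] -/
private theorem pow_lt_prod_le₃ {k : ℕ} (hk : 1 ≤ k) {y : ℝ} (hy : 0 < y) {f : Fin k → ℕ}
    (hf : ∀ j, y < (f j : ℝ) ∧ ((f j : ℕ) : ℝ) ≤ y ^ 2) :
    y ^ k < ((∏ j, f j : ℕ) : ℝ) ∧ ((∏ j, f j : ℕ) : ℝ) ≤ y ^ (2 * k) := by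
  haveI : Nonempty (Fin k) := ⟨⟨0, hk⟩⟩
  rw [Nat.cast_prod]
  constructor
  · calc y ^ k = ∏ _j : Fin k, y := by rw [Finset.prod_const, Finset.card_univ, Fintype.card_fin]
      _ < ∏ j, ((f j : ℕ) : ℝ) :=
          Finset.prod_lt_prod_of_nonempty (fun j _ => hy)
            (fun j _ => (hf j).1) Finset.univ_nonempty
  · calc ∏ j, ((f j : ℕ) : ℝ) ≤ ∏ _j : Fin k, y ^ 2 :=
          Finset.prod_le_prod (fun j _ => by positivity) fun j _ => (hf j).2
      _ = y ^ (2 * k) := by rw [Finset.prod_const, Finset.card_univ, Fintype.card_fin, ← pow_mul]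

/-- The prime factors of a product of primes from `P` lie in `P`. [folklore] -/
private theorem primeFactors_prod_subset₃ (P : Finset ℕ) (hP : ∀ p ∈ P, p.Prime) {k : ℕ}
    {f : Fin k → ℕ} (hf : ∀ j, f j ∈ P) : (∏ j, f j).primeFactors ⊆ P := by
  classical
  intro q hq
  obtain ⟨hqp, hqdvd, -⟩ := Nat.mem_primeFactors.mp hq
  obtain ⟨j, -, hj⟩ := (Nat.Prime.prime hqp).exists_mem_finset_dvd hqdvd
  rw [(Nat.prime_dvd_prime_iff_eq hqp (hP _ (hf j))).mp hj]
  exact hf j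

/-- `log 1500 ≥ 7` (`e⁷ < 2.7182818286⁷ < 1097`). [folklore] -/
private theorem seven_le_log {D : ℕ} (hD : 1500 ≤ D) : 7 ≤ Real.log D := by
  have hD' : (1500 : ℝ) ≤ D := by exact_mod_cast hD
  rw [Real.le_log_iff_exp_le (by linarith)]
  have h1 := Real.exp_one_lt_d9
  have h7 : Real.exp 7 = Real.exp 1 ^ 7 := by rw [← Real.exp_nat_mul]; norm_num
  rw [h7]
  have : Real.exp 1 ^ 7 ≤ 2.7182818286 ^ 7 := by gcongr
  linarith [show (2.7182818286 : ℝ) ^ 7 ≤ 1500 by norm_num]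

/-- `log 12000 ≥ 9` (`e⁹ < 2.7182818286⁹ < 8104`). [folklore] -/
private theorem nine_le_log {D : ℕ} (hD : 12000 ≤ D) : 9 ≤ Real.log D := by
  have hD' : (12000 : ℝ) ≤ D := by exact_mod_cast hD
  rw [Real.le_log_iff_exp_le (by linarith)]
  have h1 := Real.exp_one_lt_d9
  have h9 : Real.exp 9 = Real.exp 1 ^ 9 := by rw [← Real.exp_nat_mul]; norm_num
  rw [h9]
  have : Real.exp 1 ^ 9 ≤ 2.7182818286 ^ 9 := by gcongr
  linarith [show (2.7182818286 : ℝ) ^ 9 ≤ 12000 by norm_num]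

variable {D : ℕ} [NeZero D] (χ : DirichletCharacter ℂ D)

/-- **`π/√D ≤ L(1, χ)`** for a real primitive character mod `D ≥ 1500` (odd: the class number
formula, `h ≥ 1`, `w = 2`; even: `√D·L(1) ≥ log(D − 4) ≥ 7 > π`). This is the input
"`√D·L(1) ≥ π`" of p. 287 ((1.2) of part II). [cite: Pintz1976ElementaryII, §5 (5.4) p. 287] -/
theorem pi_div_sqrt_le_lOne_re (hprim : χ.IsPrimitive) (hquad : χ.IsQuadratic) (hD : 1500 ≤ D) :
    Real.pi / Real.sqrt D ≤ (χ.LFunction 1).re := by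
  have hne : χ ≠ 1 := by
    intro h1
    have hc : χ.conductor = 1 := by rw [h1]; exact DirichletCharacter.conductor_one
    rw [hprim] at hc
    omega
  have hq : χ ^ 2 = 1 := MulChar.IsQuadratic.sq_eq_one hquad
  have hD' : (1500 : ℝ) ≤ D := by exact_mod_cast hD
  have hsD : 0 < Real.sqrt D := Real.sqrt_pos.2 (by linarith)
  rw [Siegel.LFunction_one_re_eq_norm χ hne hq, div_le_iff₀ hsD, mul_comm]
  rcases χ.even_or_odd with heven | hodd
  · have h := RealZeroRepulsion.sqrt_mul_norm_LFunction_one_ge_log_sub_four_of_even (by omega)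
      hprim hquad heven
    have h7 : 7 ≤ Real.log ((D : ℝ) - 4) := by
      rw [Real.le_log_iff_exp_le (by linarith)]
      have h1 := Real.exp_one_lt_d9
      have h7 : Real.exp 7 = Real.exp 1 ^ 7 := by rw [← Real.exp_nat_mul]; norm_num
      rw [h7]
      have : Real.exp 1 ^ 7 ≤ 2.7182818286 ^ 7 := by gcongr
      linarith [show (2.7182818286 : ℝ) ^ 7 ≤ 1496 by norm_num]
    linarith [Real.pi_lt_d2]
  · exact RealZeroRepulsion.sqrt_mul_norm_LFunction_one_ge_pi_of_odd (by omega) hprim hquad hodd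

omit [NeZero D] in
/-- **`α ≤ 8 log D/log A`** unconditionally (the hypothesis of the selection step): for
`2 ≤ A ≤ D²`, `D ≥ 1500`, every sub-sum of `Σ_{A<p≤D²} 1/p` is at most
`log log D² − log log A + 4/log D + 8/log A` (Mertens' second theorem with rate, twice), and
`log(M/4) + 4/L + M/L ≤ M` for `M = 8L/log A ≥ 4`, `L = log D ≥ 7`.
[cite: Pintz1976ElementaryII, §5 proof of Lemma 3 p. 286] [cite: HardyWright2008, Thm 427] -/
theorem sum_inv_primes_le_exponent (hD : 1500 ≤ D) {A : ℝ} (hA2 : 2 ≤ A) (hAD : A ≤ (D : ℝ) ^ 2)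
    {S : Finset ℕ} (hS : S ⊆ (Finset.range (D ^ 2 + 1)).filter
      (fun p : ℕ => p.Prime ∧ A < (p : ℝ))) :
    ∑ p ∈ S, 1 / (p : ℝ) ≤ 8 * Real.log D / Real.log A := by
  classical
  set L : ℝ := Real.log D with hL
  set ℓ : ℝ := Real.log A with hℓ
  have hD' : (1500 : ℝ) ≤ D := by exact_mod_cast hD
  have hD0 : (0 : ℝ) < D := by linarith
  have hL7 : 7 ≤ L := seven_le_log hD
  have hLpos : 0 < L := by linarith
  have hA0 : 0 < A := by linarith
  have hℓpos : 0 < ℓ := Real.log_pos (by linarith)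
  have hℓ2L : ℓ ≤ 2 * L := by
    have h := Real.log_le_log hA0 hAD
    rw [Real.log_pow] at h; push_cast at h; linarith
  -- Mertens at `D²` and at `A`
  have hPD : primeRecipSum ((D : ℝ) ^ 2) = ∑ p ∈ (Finset.range (D ^ 2 + 1)).filter Nat.Prime,
      1 / (p : ℝ) := by
    rw [primeRecipSum, show ((D : ℝ) ^ 2) = ((D ^ 2 : ℕ) : ℝ) by push_cast; ring,
      Nat.floor_natCast, Nat.primesLE_eq_filter_range]
    exact Finset.sum_congr rfl fun p _ => (one_div _).symm
  have hPA : primeRecipSum A = ∑ p ∈ Nat.primesLE ⌊A⌋₊, 1 / (p : ℝ) := by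
    rw [primeRecipSum]; exact Finset.sum_congr rfl fun p _ => (one_div _).symm
  have hD2r : (2 : ℝ) ≤ (D : ℝ) ^ 2 := by nlinarith
  have hMD := abs_primeRecipSum_sub_le hD2r
  rw [show Real.log ((D : ℝ) ^ 2) = 2 * L by rw [Real.log_pow, hL]; push_cast; ring, hPD] at hMD
  have hMA := abs_primeRecipSum_sub_le hA2
  rw [hPA] at hMA
  obtain ⟨-, hMD2⟩ := abs_le.mp hMD
  obtain ⟨hMA1, -⟩ := abs_le.mp hMA
  -- split `Σ_{p ≤ D²} 1/p` at `A`
  set Sall : Finset ℕ := (Finset.range (D ^ 2 + 1)).filter Nat.Prime with hSall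
  have hlow : Sall.filter (fun p : ℕ => ¬ A < (p : ℝ)) = Nat.primesLE ⌊A⌋₊ := by
    ext p
    rw [hSall, Finset.mem_filter, Finset.mem_filter, Finset.mem_range, Nat.mem_primesLE, not_lt]
    constructor
    · rintro ⟨⟨-, hp⟩, hle⟩; exact ⟨Nat.le_floor hle, hp⟩
    · rintro ⟨hle, hp⟩
      have hAfloor : (⌊A⌋₊ : ℝ) ≤ (D : ℝ) ^ 2 := (Nat.floor_le hA0.le).trans hAD
      have hAfloor' : ⌊A⌋₊ ≤ D ^ 2 := by exact_mod_cast hAfloor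
      refine ⟨⟨by omega, hp⟩, ?_⟩
      exact le_trans (by exact_mod_cast hle) (Nat.floor_le hA0.le)
  have hsplit := Finset.sum_filter_add_sum_filter_not Sall (fun p : ℕ => A < (p : ℝ))
    (fun p : ℕ => 1 / (p : ℝ))
  rw [hlow] at hsplit
  have hSle : ∑ p ∈ S, 1 / (p : ℝ) ≤ ∑ p ∈ Sall.filter (fun p : ℕ => A < (p : ℝ)), 1 / (p : ℝ) := by
    refine Finset.sum_le_sum_of_subset_of_nonneg (fun p hp => ?_) fun p _ _ => by positivity
    have := hS hp
    rw [Finset.mem_filter] at this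
    rw [Finset.mem_filter, hSall, Finset.mem_filter]
    exact ⟨⟨this.1, this.2.1⟩, this.2.2⟩
  -- `Σ_S ≤ P(D²) − P(A) ≤ log(2L) − log ℓ + 4/L + 8/ℓ`
  have h1 : ∑ p ∈ S, 1 / (p : ℝ) ≤ Real.log (2 * L) - Real.log ℓ + 8 / (2 * L) + 8 / ℓ := by
    linarith
  -- `M = 8L/ℓ ≥ 4`; `log(2L) − log ℓ = log(M/4) ≤ M/4 − 1`
  set M : ℝ := 8 * L / ℓ with hM
  have hM4 : 4 ≤ M := by rw [hM, le_div_iff₀ hℓpos]; linarith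
  have hMpos : 0 < M := by linarith
  have h2 : Real.log (2 * L) - Real.log ℓ = Real.log (M / 4) := by
    rw [Real.log_div (by positivity) (by norm_num), hM, Real.log_div (by positivity) hℓpos.ne',
      Real.log_mul (by norm_num) hLpos.ne', Real.log_mul (by norm_num) hLpos.ne',
      show (8 : ℝ) = 2 * 4 by norm_num, Real.log_mul (by norm_num) (by norm_num)]
    ring
  have h3 : Real.log (M / 4) ≤ M / 4 - 1 := Real.log_le_sub_one_of_pos (by positivity)
  have h4 : 8 / ℓ = M / L := by rw [hM]; field_simp
  have h5 : 8 / (2 * L) ≤ 4 / 7 := by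
    rw [div_le_div_iff₀ (by positivity) (by norm_num)]; linarith
  have h6 : M / L ≤ M / 7 := div_le_div_of_nonneg_left hMpos.le (by norm_num) hL7
  linarith

omit [NeZero D] in
/-- **The Montgomery–Vaughan error with an optimised cut**: for `N ≥ D²`, `D ≥ 1500`,
`log N ≤ 8 log D`, with `W = 8√D(1 + log D)(log N + 1)` and `Y = ⌊√(WN)/2⌋` one has
`2 ≤ Y ≤ N` and `W/(Y + 1) + 4Y/N ≤ 4√(W/N)`. (The sibling file takes `Y = ⌊√N⌋`, which costs a
factor `D^{1/4}`; the optimised cut is what lets the printed range `C ∈ [D², D⁴)` through.)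
[cite: MontgomeryVaughan2007, §11.2.1 Exercise 3(g)] -/
theorem mv_error_opt (hD : 1500 ≤ D) {N : ℕ} (hN : D ^ 2 ≤ N) (hlogN : Real.log N ≤ 8 * Real.log D) :
    ∃ Y : ℕ, 2 ≤ Y ∧ Y ≤ N ∧
      8 * (Real.sqrt D * (1 + Real.log D)) * (Real.log N + 1) / ((Y : ℝ) + 1) + 4 * (Y : ℝ) / N ≤
        4 * Real.sqrt (8 * (Real.sqrt D * (1 + Real.log D)) * (Real.log N + 1) / N) := by
  have hD' : (1500 : ℝ) ≤ D := by exact_mod_cast hD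
  have hD0 : (0 : ℝ) < D := by linarith
  have hL7 : 7 ≤ Real.log D := seven_le_log hD
  have hsD : 0 < Real.sqrt D := Real.sqrt_pos.2 hD0
  have hsD1 : 1 ≤ Real.sqrt D := by
    rw [show (1 : ℝ) = Real.sqrt 1 by simp]; exact Real.sqrt_le_sqrt (by linarith)
  have hNr : (D : ℝ) ^ 2 ≤ N := by exact_mod_cast hN
  have hN0 : (0 : ℝ) < N := lt_of_lt_of_le (by positivity) hNr
  have hN1 : (1 : ℝ) ≤ N := le_trans (by nlinarith) hNr
  have hlogN0 : 0 ≤ Real.log N := Real.log_nonneg hN1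
  set B : ℝ := Real.sqrt D * (1 + Real.log D) with hB
  set W : ℝ := 8 * B * (Real.log N + 1) with hW
  have hB1 : 1 ≤ B := by
    have : (1 : ℝ) ≤ 1 + Real.log D := by linarith
    calc (1 : ℝ) = 1 * 1 := by ring
      _ ≤ Real.sqrt D * (1 + Real.log D) := mul_le_mul hsD1 this zero_le_one hsD.le
  have hW8 : 8 ≤ W := by
    have : (1 : ℝ) ≤ Real.log N + 1 := by linarith
    calc (8 : ℝ) = 8 * 1 * 1 := by ring
      _ ≤ 8 * B * (Real.log N + 1) := by gcongr
  have hW0 : 0 < W := by linarith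
  -- `W ≤ 4N`: `log D ≤ √D` gives `W ≤ 8√D(1 + √D)(8√D + 1) ≤ 4D²`
  have hlogsqrt : Real.log D ≤ Real.sqrt D := by
    have h4 := Real.log_le_rpow_div hD0.le (show (0 : ℝ) < 1 / 4 by norm_num)
    set u : ℝ := (D : ℝ) ^ ((1 : ℝ) / 4) with hu
    have hu0 : 0 < u := Real.rpow_pos_of_pos hD0 _
    have hu2 : u ^ 2 = Real.sqrt D := by
      rw [hu, ← Real.rpow_natCast, ← Real.rpow_mul hD0.le, Real.sqrt_eq_rpow]; norm_num
    have hu4 : 4 ≤ u := by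
      have hs16 : (16 : ℝ) ≤ Real.sqrt D := by
        rw [show (16 : ℝ) = Real.sqrt (16 ^ 2) by rw [Real.sqrt_sq (by norm_num)]]
        exact Real.sqrt_le_sqrt (by linarith)
      nlinarith [hu2, hu0]
    have h5 : Real.log D ≤ 4 * u := by
      have : u / (1 / 4) = 4 * u := by ring
      rw [this] at h4; exact h4
    calc Real.log D ≤ 4 * u := h5
      _ ≤ u * u := by nlinarith
      _ = Real.sqrt D := by rw [← hu2]; ring
  have hsDD : Real.sqrt D * Real.sqrt D = D := Real.mul_self_sqrt hD0.le
  have hWN : W ≤ 4 * N := by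
    have h1 : Real.log N + 1 ≤ 8 * Real.sqrt D + 1 := by linarith
    have h2 : 1 + Real.log D ≤ 1 + Real.sqrt D := by linarith
    have h3 : W ≤ 8 * (Real.sqrt D * (1 + Real.sqrt D)) * (8 * Real.sqrt D + 1) := by
      simp only [hW, hB]; gcongr
    -- `8 s (1+s)(8s+1) ≤ 4 s⁴` for `s ≥ 38`
    have hs38 : (38 : ℝ) ≤ Real.sqrt D := by
      rw [show (38 : ℝ) = Real.sqrt (38 ^ 2) by rw [Real.sqrt_sq (by norm_num)]]
      exact Real.sqrt_le_sqrt (by linarith)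
    have h4 : 8 * (Real.sqrt D * (1 + Real.sqrt D)) * (8 * Real.sqrt D + 1) ≤ 4 * (D : ℝ) ^ 2 := by
      rw [show ((D : ℝ)) ^ 2 = (Real.sqrt D * Real.sqrt D) * (Real.sqrt D * Real.sqrt D) by
        rw [hsDD]; ring]
      nlinarith [hs38, mul_pos hsD hsD, mul_pos (mul_pos hsD hsD) hsD]
    linarith
  -- the cut
  set r : ℝ := Real.sqrt (W * N) with hr
  have hr0 : 0 < r := Real.sqrt_pos.2 (by positivity)
  have hr4 : 4 ≤ r := by
    rw [hr, show (4 : ℝ) = Real.sqrt (4 ^ 2) by rw [Real.sqrt_sq (by norm_num)]]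
    exact Real.sqrt_le_sqrt (by nlinarith)
  set Y : ℕ := ⌊r / 2⌋₊ with hY
  have hYle : (Y : ℝ) ≤ r / 2 := Nat.floor_le (by positivity)
  have hYgt : r / 2 < (Y : ℝ) + 1 := Nat.lt_floor_add_one _
  refine ⟨Y, ?_, ?_, ?_⟩
  · exact Nat.le_floor (by push_cast; linarith)
  · have : (Y : ℝ) ≤ N := by
      refine hYle.trans ?_
      -- `r/2 ≤ N` iff `r ≤ 2N` iff `WN ≤ 4N²`
      have h1 : r ≤ 2 * N := by
        rw [hr, show (2 : ℝ) * N = Real.sqrt ((2 * N) ^ 2) by rw [Real.sqrt_sq (by positivity)]]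
        exact Real.sqrt_le_sqrt (by nlinarith)
      linarith
    exact_mod_cast this
  · -- `W/(Y+1) ≤ 2W/r = 2√(W/N)` and `4Y/N ≤ 2r/N = 2√(W/N)`
    have hrr : r * r = W * N := Real.mul_self_sqrt (by positivity)
    have hsq : Real.sqrt (W / N) = r / N := by
      rw [show W / (N : ℝ) = (W * N) / ((N : ℝ) ^ 2) by
        rw [div_eq_div_iff hN0.ne' (by positivity)]; ring,
        Real.sqrt_div' _ (by positivity), Real.sqrt_sq hN0.le]
    have e1 : 8 * B * (Real.log N + 1) / ((Y : ℝ) + 1) ≤ 2 * (r / N) := by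
      rw [← hW, div_le_iff₀ (by positivity)]
      -- `W ≤ 2 (r/N) (Y+1)`, from `W = r²/N` and `r/2 < Y+1`
      have : W = r * r / N := by rw [hrr]; field_simp
      rw [this]
      rw [show r * r / N = 2 * (r / N) * (r / 2) by ring]
      exact mul_le_mul_of_nonneg_left hYgt.le (by positivity)
    have e2 : 4 * (Y : ℝ) / N ≤ 2 * (r / N) := by
      rw [div_le_iff₀ hN0]
      have : 2 * (r / N) * N = 2 * r := by field_simp
      rw [this]; linarith
    rw [hsq]
    linarith

/-- The numerical inequality of the large-`D` regime (`L = log D ≥ 9`, `u = D^{1/4} ≥ 10.4`):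
`11.32 (2L + 1.25) ≤ π (L − 0.7) u`. [folklore] -/
private theorem large_regime_numerics {L u : ℝ} (hL : 9 ≤ L) (hu : 10.4 ≤ u) :
    11.32 * (2 * L + 1.25) ≤ Real.pi * (L - 0.7) * u := by
  have hπ := Real.pi_gt_d2
  have h1 : 2 * L + 1.25 ≤ 2.4 * (L - 0.7) := by linarith
  have h2 : (0 : ℝ) ≤ L - 0.7 := by linarith
  calc 11.32 * (2 * L + 1.25) ≤ 11.32 * (2.4 * (L - 0.7)) := by nlinarith
    _ = 27.168 * (L - 0.7) := by ring
    _ ≤ 3.14 * (L - 0.7) * 10.4 := by nlinarith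
    _ ≤ Real.pi * (L - 0.7) * u := by
        have := mul_le_mul hπ.le hu (by norm_num) Real.pi_pos.le
        nlinarith [mul_nonneg h2 (show (0:ℝ) ≤ Real.pi * u - 3.14 * 10.4 by nlinarith)]

/-- First Montgomery–Vaughan error of the large-`D` regime: with `u² = √D`, `P² ≥ (1+L)(4L+1)`,
`N₁ ≥ D²`, `log N₁ ≤ 4L`: `√(8√D(1+L)(log N₁+1)/N₁) ≤ 2.829 uP/D` (`2.829² ≥ 8`). [folklore] -/
private theorem err_one_le {D : ℕ} {u L P : ℝ} (hD0 : (0 : ℝ) < D) (hu2 : u ^ 2 = Real.sqrt D)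
    (hu0 : 0 < u) (hP0 : 0 < P) (hL0 : 0 ≤ L) (hQ : (1 + L) * (4 * L + 1) ≤ P ^ 2) {N₁ : ℕ}
    (hN₁ : (D : ℝ) ^ 2 ≤ N₁) (hlogN₁ : Real.log N₁ ≤ 4 * L) :
    Real.sqrt (8 * (Real.sqrt D * (1 + L)) * (Real.log N₁ + 1) / N₁) ≤ 2.829 * u * P / D := by
  have hnum : 8 * (Real.sqrt D * (1 + L)) * (Real.log N₁ + 1) ≤ 8 * u ^ 2 * P ^ 2 := by
    have ha : Real.log N₁ + 1 ≤ 4 * L + 1 := by linarith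
    have hb : (1 + L) * (Real.log N₁ + 1) ≤ (1 + L) * (4 * L + 1) :=
      mul_le_mul_of_nonneg_left ha (by linarith)
    calc 8 * (Real.sqrt D * (1 + L)) * (Real.log N₁ + 1)
        = 8 * Real.sqrt D * ((1 + L) * (Real.log N₁ + 1)) := by ring
      _ ≤ 8 * Real.sqrt D * P ^ 2 :=
          mul_le_mul_of_nonneg_left (hb.trans hQ) (by rw [← hu2]; positivity)
      _ = 8 * u ^ 2 * P ^ 2 := by rw [hu2]
  have hX : 8 * (Real.sqrt D * (1 + L)) * (Real.log N₁ + 1) / N₁ ≤ (2.829 * u * P / D) ^ 2 := by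
    have h1 : 8 * (Real.sqrt D * (1 + L)) * (Real.log N₁ + 1) / N₁ ≤
        8 * u ^ 2 * P ^ 2 / (D : ℝ) ^ 2 :=
      div_le_div₀ (by positivity) hnum (by positivity) hN₁
    have h2 : 8 * u ^ 2 * P ^ 2 / (D : ℝ) ^ 2 ≤ (2.829 * u * P / D) ^ 2 := by
      rw [show (2.829 * u * P / (D : ℝ)) ^ 2 = 8.003241 * (u ^ 2 * P ^ 2) / (D : ℝ) ^ 2 by ring]
      refine div_le_div_of_nonneg_right ?_ (by positivity)
      nlinarith [show (0 : ℝ) ≤ u ^ 2 * P ^ 2 by positivity]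
    exact h1.trans h2
  calc _ ≤ Real.sqrt ((2.829 * u * P / D) ^ 2) := Real.sqrt_le_sqrt hX
    _ = 2.829 * u * P / D := Real.sqrt_sq (by positivity)

/-- Second Montgomery–Vaughan error of the large-`D` regime: with `N₂ ≥ D⁴`, `log N₂ ≤ 8L`:
`√(8√D(1+L)(log N₂+1)/N₂) ≤ 4.01 uP/D²` (`4.01² ≥ 16`). [folklore] -/
private theorem err_two_le {D : ℕ} {u L P : ℝ} (hD0 : (0 : ℝ) < D) (hu2 : u ^ 2 = Real.sqrt D)
    (hu0 : 0 < u) (hP0 : 0 < P) (hL0 : 0 ≤ L) (hQ : (1 + L) * (4 * L + 1) ≤ P ^ 2) {N₂ : ℕ}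
    (hN₂ : (D : ℝ) ^ 4 ≤ N₂) (hlogN₂ : Real.log N₂ ≤ 8 * L) :
    Real.sqrt (8 * (Real.sqrt D * (1 + L)) * (Real.log N₂ + 1) / N₂) ≤
      4.01 * u * P / (D : ℝ) ^ 2 := by
  have hnum : 8 * (Real.sqrt D * (1 + L)) * (Real.log N₂ + 1) ≤ 16 * u ^ 2 * P ^ 2 := by
    have ha : Real.log N₂ + 1 ≤ 2 * (4 * L + 1) := by linarith
    have hb : (1 + L) * (Real.log N₂ + 1) ≤ (1 + L) * (2 * (4 * L + 1)) :=
      mul_le_mul_of_nonneg_left ha (by linarith)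
    have hc : (1 + L) * (2 * (4 * L + 1)) ≤ 2 * P ^ 2 := by nlinarith [hQ]
    calc 8 * (Real.sqrt D * (1 + L)) * (Real.log N₂ + 1)
        = 8 * Real.sqrt D * ((1 + L) * (Real.log N₂ + 1)) := by ring
      _ ≤ 8 * Real.sqrt D * (2 * P ^ 2) :=
          mul_le_mul_of_nonneg_left (hb.trans hc) (by rw [← hu2]; positivity)
      _ = 16 * u ^ 2 * P ^ 2 := by rw [hu2]; ring
  have hX : 8 * (Real.sqrt D * (1 + L)) * (Real.log N₂ + 1) / N₂ ≤
      (4.01 * u * P / (D : ℝ) ^ 2) ^ 2 := by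
    have h1 : 8 * (Real.sqrt D * (1 + L)) * (Real.log N₂ + 1) / N₂ ≤
        16 * u ^ 2 * P ^ 2 / (D : ℝ) ^ 4 :=
      div_le_div₀ (by positivity) hnum (by positivity) hN₂
    have h2 : 16 * u ^ 2 * P ^ 2 / (D : ℝ) ^ 4 ≤ (4.01 * u * P / (D : ℝ) ^ 2) ^ 2 := by
      rw [show (4.01 * u * P / (D : ℝ) ^ 2) ^ 2 = 16.0801 * (u ^ 2 * P ^ 2) / (D : ℝ) ^ 4 by ring]
      refine div_le_div_of_nonneg_right ?_ (by positivity)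
      nlinarith [show (0 : ℝ) ≤ u ^ 2 * P ^ 2 by positivity]
    exact h1.trans h2
  calc _ ≤ Real.sqrt ((4.01 * u * P / (D : ℝ) ^ 2) ^ 2) := Real.sqrt_le_sqrt hX
    _ = 4.01 * u * P / (D : ℝ) ^ 2 := Real.sqrt_sq (by positivity)

/-- The sum of the two error bounds: for `D ≥ 12000`, `u⁴ = D`, `u² = √D` and
`11.32(2L + 1.25) ≤ π(L − 0.7)u`: `4·(2.829uP/D) + 4·(4.01uP/D²) ≤ (L − 0.7)π/√D`, `P = 2L + 1.25`.
[folklore] -/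
private theorem err_sum_le {D : ℕ} {u L : ℝ} (hD : (12000 : ℝ) ≤ D) (hu4 : u ^ 4 = D)
    (hu2 : u ^ 2 = Real.sqrt D) (hu0 : 0 < u) (hL : 9 ≤ L)
    (key : 11.32 * (2 * L + 1.25) ≤ Real.pi * (L - 0.7) * u) :
    4 * (2.829 * u * (2 * L + 1.25) / D) + 4 * (4.01 * u * (2 * L + 1.25) / (D : ℝ) ^ 2) ≤
      (L - 0.7) * (Real.pi / Real.sqrt D) := by
  set P : ℝ := 2 * L + 1.25 with hP
  have hD0 : (0 : ℝ) < D := by linarith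
  have hP0 : 0 < P := by simp only [hP]; linarith
  have huP : 0 ≤ u * P := by positivity
  have h1 : 4 * (4.01 * u * P / (D : ℝ) ^ 2) ≤ 0.004 * (u * P) / D := by
    rw [show 4 * (4.01 * u * P / (D : ℝ) ^ 2) = 16.04 * (u * P) / (D : ℝ) ^ 2 by ring,
      div_le_div_iff₀ (by positivity) hD0]
    have h' : (16.04 : ℝ) ≤ 0.004 * D := by linarith
    calc 16.04 * (u * P) * (D : ℝ) = 16.04 * ((u * P) * D) := by ring
      _ ≤ (0.004 * D) * ((u * P) * D) := mul_le_mul_of_nonneg_right h' (by positivity)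
      _ = 0.004 * (u * P) * (D : ℝ) ^ 2 := by ring
  have h2 : 4 * (2.829 * u * P / (D : ℝ)) + 0.004 * (u * P) / D = 11.32 * (u * P) / D := by
    field_simp
    ring
  have hfin : 11.32 * (u * P) / D ≤ (L - 0.7) * (Real.pi / Real.sqrt D) := by
    rw [div_le_iff₀ hD0]
    have e : (L - 0.7) * (Real.pi / Real.sqrt D) * D = (L - 0.7) * Real.pi * u * u := by
      rw [← hu2, ← hu4]; field_simp
    rw [e]
    calc 11.32 * (u * P) = (11.32 * (2 * L + 1.25)) * u := by simp only [hP]; ring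
      _ ≤ (Real.pi * (L - 0.7) * u) * u := mul_le_mul_of_nonneg_right key hu0.le
      _ = (L - 0.7) * Real.pi * u * u := by ring
  linarith [h1, h2, hfin]

/-- The two Montgomery–Vaughan errors of the large-`D` regime add up to at most `(L − 0.7)·π/√D`:
with `N₁ ≥ D²`, `log N₁ ≤ 4L`, `N₂ ≥ D⁴`, `log N₂ ≤ 8L`, `L = log D ≥ 9`, `u = D^{1/4} ≥ 10.4`:
`4√(8√D(1+L)(log N₁+1)/N₁) + 4√(8√D(1+L)(log N₂+1)/N₂) ≤ 11.32 u(2L + 1.25)/D ≤ (L − 0.7)π/√D`.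
[folklore] -/
private theorem err_total_le {D : ℕ} (hD : 12000 ≤ D) {N₁ N₂ : ℕ} (hN₁ : D ^ 2 ≤ N₁)
    (hN₂ : D ^ 4 ≤ N₂) (hlogN₁ : Real.log N₁ ≤ 4 * Real.log D)
    (hlogN₂ : Real.log N₂ ≤ 8 * Real.log D) :
    4 * Real.sqrt (8 * (Real.sqrt D * (1 + Real.log D)) * (Real.log N₁ + 1) / N₁) +
        4 * Real.sqrt (8 * (Real.sqrt D * (1 + Real.log D)) * (Real.log N₂ + 1) / N₂) ≤
      (Real.log D - 0.7) * (Real.pi / Real.sqrt D) := by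
  set L : ℝ := Real.log D with hL
  have hD' : (12000 : ℝ) ≤ D := by exact_mod_cast hD
  have hD0 : (0 : ℝ) < D := by linarith
  have hL9 : 9 ≤ L := nine_le_log hD
  have hL0 : 0 ≤ L := by linarith
  -- `u = D^{1/4}`
  set u : ℝ := (D : ℝ) ^ ((1 : ℝ) / 4) with hu
  have hu0 : 0 < u := Real.rpow_pos_of_pos hD0 _
  have hu2 : u ^ 2 = Real.sqrt D := by
    rw [hu, ← Real.rpow_natCast, ← Real.rpow_mul hD0.le, Real.sqrt_eq_rpow]; norm_num
  have hu4 : u ^ 4 = D := by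
    rw [hu, ← Real.rpow_natCast, ← Real.rpow_mul hD0.le]; norm_num
  have hu10 : 10.4 ≤ u := by
    have h1 : (10.4 : ℝ) ^ 4 ≤ u ^ 4 := by
      rw [hu4]; linarith [show (10.4 : ℝ) ^ 4 ≤ 12000 by norm_num]
    exact le_of_pow_le_pow_left₀ (by norm_num) hu0.le h1
  have key := large_regime_numerics hL9 hu10
  set P : ℝ := 2 * L + 1.25 with hP
  have hP0 : 0 < P := by simp only [hP]; linarith
  have hQ : (1 + L) * (4 * L + 1) ≤ P ^ 2 := by simp only [hP]; nlinarith
  have hN₁r : (D : ℝ) ^ 2 ≤ N₁ := by exact_mod_cast hN₁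
  have hN₂r : (D : ℝ) ^ 4 ≤ N₂ := by exact_mod_cast hN₂
  have hA₁ := err_one_le hD0 hu2 hu0 hP0 hL0 hQ hN₁r hlogN₁
  have hA₂ := err_two_le hD0 hu2 hu0 hP0 hL0 hQ hN₂r hlogN₂
  have hS := err_sum_le hD' hu4 hu2 hu0 hL9 key
  rw [← hP] at hS
  linarith [hA₁, hA₂, hS]

end Helpers

/-! ### Lemma 3 as printed -/

section LemmaThree

/-- **Pintz 1976 (II), Lemma 3 — PROVED as printed** ("For a non-principal real character
`χ (mod D)` (`≥ 1500`) for any `A`, `2 ≤ A ≤ D²`, and with the notation `Σ_{A<p≤D², χ(p)≠−1} 1/p = α`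
(5.1) the inequality `L(1) > (1/(5 log D))(α log A/(8 log D))^{8 log D/log A}` (5.2) holds", for
primitive real `χ` as typed). Road = the printed one (pp. 286–287), on the sibling file's engines:
intervals `(A^{2^{i−1}}, A^{2^i}]`, `C = A^{2^{m−1}} ∈ [D², D⁴)` (`2^m < 8 log D/log A`), products of
`2^{m−i}` primes with `χ(p) ≠ −1` lie in `(C, C²]` with multiplicity `≤ (2^{m−i})!` and `g ≥ 1`
there (`pow_sum_inv_le_factorial_mul_sum`, `one_le_g_of_forall_primeFactors`); the printed choice
of one interval "(since `α < m`)" is the sibling's selection inequality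
`rpow_div_le_of_pow_le_factorial_mul`, whose hypothesis `α ≤ 8 log D/log A` is PROVED here from
Mertens' theorem (`sum_inv_primes_le_exponent`); (5.4) `Σ_{C<n≤C²} g(n)/n < 5 log D·L(1)` is
Montgomery–Vaughan 11.2.3(g) twice (`sum_Ioc_g_div_le`) with the OPTIMISED cut `Y = ⌊√(WN)/2⌋`
(`mv_error_opt`: error `≤ 11.32 D^{1/4}(2 log D + 1.25)/D ≤ (log D − 0.7)π/√D` for `D ≥ 12000`)
and `√D·L(1) ≥ π` (`pi_div_sqrt_le_lOne_re`); for `1500 ≤ D < 12000` the claim is immediate from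
`α ≤ 8 log D/log A` (the power is `≤ 1`) and `1/(5 log D) < π/√D ≤ L(1)`. Discharges the named fact
`pintz1976_lemma3`. [cite: Pintz1976ElementaryII, Lemma 3 p. 286 (5.1)–(5.2); proof pp. 286–287 (5.3)–(5.4)] -/
theorem lemma3 : pintz1976_lemma3 := by
  intro D _ χ hquad hprim _hne hD A hA2 hAD
  classical
  obtain ⟨α, hα⟩ : ∃ α : ℝ, α = ∑ p ∈ (Finset.range (D ^ 2 + 1)).filter
      (fun p : ℕ => p.Prime ∧ A < (p : ℝ) ∧ χ (p : ZMod D) ≠ -1), (1 : ℝ) / (p : ℝ) := ⟨_, rfl⟩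
  rw [← hα]
  obtain ⟨L, hL⟩ : ∃ L : ℝ, L = Real.log D := ⟨_, rfl⟩
  obtain ⟨ℓ, hℓ⟩ : ∃ ℓ : ℝ, ℓ = Real.log A := ⟨_, rfl⟩
  rw [← hL, ← hℓ]
  have hq : χ ^ 2 = 1 := MulChar.IsQuadratic.sq_eq_one hquad
  have hD' : (1500 : ℝ) ≤ D := by exact_mod_cast hD
  have hD0 : (0 : ℝ) < D := by linarith only [hD']
  have hD2 : 2 ≤ D := le_trans (by norm_num) hD
  have hL7 : 7 ≤ L := by rw [hL]; exact seven_le_log hD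
  have hLpos : 0 < L := by linarith only [hL7]
  have hℓpos : 0 < ℓ := by rw [hℓ]; exact Real.log_pos (by linarith only [hA2])
  have hA0 : 0 < A := by linarith only [hA2]
  have hA1 : 1 ≤ A := by linarith only [hA2]
  have hℓ2L : ℓ ≤ 2 * L := by
    rw [hℓ, hL]
    have h := Real.log_le_log hA0 hAD
    rw [Real.log_pow] at h
    push_cast at h
    linarith only [h]
  have hlog2 : Real.log 2 < 0.7 := by
    have := Real.log_two_lt_d9; linarith only [this]
  have hsD : 0 < Real.sqrt D := Real.sqrt_pos.2 hD0
  -- `L(1) ≥ π/√D > 0`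
  have hL1 := pi_div_sqrt_le_lOne_re χ hprim hquad hD
  have hπD : 0 < Real.pi / Real.sqrt D := by positivity
  have hL1pos : 0 < (χ.LFunction 1).re := lt_of_lt_of_le hπD hL1
  -- `M = 8L/ℓ`, `α ≤ M`
  obtain ⟨M, hM⟩ : ∃ M : ℝ, M = 8 * L / ℓ := ⟨_, rfl⟩
  have hMpos : 0 < M := by rw [hM]; positivity
  have hαM : α ≤ M := by
    rw [hα, hM, hL, hℓ]
    refine sum_inv_primes_le_exponent hD hA2 hAD fun p hp => ?_
    rw [Finset.mem_filter] at hp ⊢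
    exact ⟨hp.1, hp.2.1, hp.2.2.1⟩
  have hα0 : 0 ≤ α := by rw [hα]; exact Finset.sum_nonneg fun p _ => by positivity
  rw [show α * ℓ / (8 * L) = α / M by rw [hM, div_div_eq_mul_div], ← hM]
  have hbase1 : (α / M) ^ M ≤ 1 :=
    Real.rpow_le_one (by positivity) ((div_le_one hMpos).mpr hαM) hMpos.le
  by_cases hsmall : D < 12000
  · -- small moduli: the power is `≤ 1` and `1/(5L) < π/√D ≤ L(1)`
    have h1 : 1 / (5 * L) * (α / M) ^ M ≤ 1 / (5 * L) := by
      have := mul_le_mul_of_nonneg_left hbase1 (by positivity : (0 : ℝ) ≤ 1 / (5 * L))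
      simpa using this
    have hsD' : Real.sqrt D < 109.55 := by
      have hlt : (D : ℝ) < 12000 := by exact_mod_cast hsmall
      rw [show (109.55 : ℝ) = Real.sqrt (109.55 ^ 2) by rw [Real.sqrt_sq (by norm_num)]]
      exact Real.sqrt_lt_sqrt hD0.le (by nlinarith only [hlt])
    have h2 : 1 / (5 * L) < Real.pi / Real.sqrt D := by
      rw [div_lt_div_iff₀ (by positivity) hsD]
      have hπ := Real.pi_gt_d6
      nlinarith only [hπ, hsD', hL7, hsD]
    linarith only [h1, h2, hL1]
  push Not at hsmall
  -- large moduli: `D ≥ 12000`, `L ≥ 9`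
  have hL9 : 9 ≤ L := by rw [hL]; exact nine_le_log hsmall
  -- `t = 4L/ℓ ≥ 2`, `m = ⌈log₂ t⌉`, `K = 2^{m−1}`: `K < t ≤ 2K`
  obtain ⟨t, ht⟩ : ∃ t : ℝ, t = 4 * L / ℓ := ⟨_, rfl⟩
  have ht2 : 2 ≤ t := by rw [ht, le_div_iff₀ hℓpos]; linarith only [hℓ2L]
  have ht0 : 0 ≤ t := by linarith only [ht2]
  obtain ⟨m, hm⟩ : ∃ m : ℕ, m = Nat.clog 2 ⌈t⌉₊ := ⟨_, rfl⟩
  have hceil1 : 1 < ⌈t⌉₊ := Nat.lt_ceil.mpr (by push_cast; linarith only [ht2])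
  have htm : t ≤ (2 : ℝ) ^ m := by
    have h1 := Nat.le_pow_clog one_lt_two ⌈t⌉₊
    rw [← hm] at h1
    calc t ≤ ⌈t⌉₊ := Nat.le_ceil t
      _ ≤ ((2 ^ m : ℕ) : ℝ) := by exact_mod_cast h1
      _ = (2 : ℝ) ^ m := by push_cast; ring
  have hm1 : 1 ≤ m := by
    rcases Nat.eq_zero_or_pos m with h0 | h0
    · rw [h0, pow_zero] at htm; linarith only [htm, ht2]
    · exact h0
  obtain ⟨K, hK⟩ : ∃ K : ℕ, K = 2 ^ (m - 1) := ⟨_, rfl⟩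
  have hK1 : 1 ≤ K := by rw [hK]; exact Nat.one_le_two_pow
  have h2K : 2 * K = 2 ^ m := by
    rw [hK, ← pow_succ']; congr 1; omega
  have hKt : (K : ℝ) < t := by
    have h1 := Nat.pow_pred_clog_lt_self one_lt_two hceil1
    rw [← hm, Nat.pred_eq_sub_one, ← hK] at h1
    have h2 : (K : ℝ) + 1 ≤ (⌈t⌉₊ : ℝ) := by exact_mod_cast h1
    linarith only [h2, Nat.ceil_lt_add_one ht0]
  have h2Kt : t ≤ 2 * (K : ℝ) := by
    calc t ≤ (2 : ℝ) ^ m := htm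
      _ = ((2 ^ m : ℕ) : ℝ) := by push_cast; ring
      _ = 2 * (K : ℝ) := by rw [← h2K]; push_cast; ring
  have hKℓ4 : (K : ℝ) * ℓ < 4 * L := by
    rw [ht, lt_div_iff₀ hℓpos] at hKt; linarith only [hKt]
  have hKℓ2 : 2 * L ≤ (K : ℝ) * ℓ := by
    rw [ht, div_le_iff₀ hℓpos] at h2Kt; linarith only [h2Kt]
  have hMm : (2 : ℝ) ^ m ≤ M := by
    rw [hM, le_div_iff₀ hℓpos]
    have : (2 : ℝ) ^ m = 2 * K := by
      rw [show (2 : ℝ) ^ m = ((2 ^ m : ℕ) : ℝ) by push_cast; ring, ← h2K]; push_cast; ring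
    rw [this]; nlinarith only [hKℓ4]
  -- `C = A^K ∈ [D², D⁴)`
  obtain ⟨C, hC⟩ : ∃ C : ℝ, C = A ^ K := ⟨_, rfl⟩
  have hC0 : 0 < C := by rw [hC]; positivity
  have hlogC : Real.log C = K * ℓ := by rw [hC, Real.log_pow, hℓ]
  have hCD2 : (D : ℝ) ^ 2 ≤ C := by
    have h1 : Real.log ((D : ℝ) ^ 2) ≤ Real.log C := by
      rw [Real.log_pow, hlogC, ← hL]; push_cast; linarith only [hKℓ2]
    exact (Real.log_le_log_iff (by positivity) hC0).mp h1
  have hD2ge : (12000 : ℝ) ≤ (D : ℝ) ^ 2 := by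
    have hD'' : (12000 : ℝ) ≤ D := by exact_mod_cast hsmall
    nlinarith only [hD'']
  have hC2 : 2 ≤ C := by linarith only [hD2ge, hCD2]
  have hCC : C ≤ C ^ 2 := by nlinarith only [hC2]
  -- `N₁ = ⌊C⌋`, `N₂ = ⌊C²⌋`
  obtain ⟨N₁, hN₁⟩ : ∃ N₁ : ℕ, N₁ = ⌊C⌋₊ := ⟨_, rfl⟩
  obtain ⟨N₂, hN₂⟩ : ∃ N₂ : ℕ, N₂ = ⌊C ^ 2⌋₊ := ⟨_, rfl⟩
  have hN₁D : D ^ 2 ≤ N₁ := by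
    rw [hN₁]; exact Nat.le_floor (by push_cast; exact hCD2)
  have hN₁₂ : N₁ ≤ N₂ := by rw [hN₁, hN₂]; exact Nat.floor_le_floor hCC
  have hN₂D : D ^ 4 ≤ N₂ := by
    rw [hN₂]; refine Nat.le_floor ?_; push_cast
    calc ((D : ℝ)) ^ 4 = ((D : ℝ) ^ 2) ^ 2 := by ring
      _ ≤ C ^ 2 := by gcongr
  have hN₂D2 : D ^ 2 ≤ N₂ := hN₁D.trans hN₁₂
  have hN₁r : C / 2 ≤ (N₁ : ℝ) := by
    have h1 : C < (N₁ : ℝ) + 1 := by rw [hN₁]; exact Nat.lt_floor_add_one C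
    linarith only [h1, hC2]
  have hN₁le : (N₁ : ℝ) ≤ C := by rw [hN₁]; exact Nat.floor_le hC0.le
  have hN₂r : (N₂ : ℝ) ≤ C ^ 2 := by rw [hN₂]; exact Nat.floor_le (by positivity)
  have hN₁pos : (0 : ℝ) < N₁ := by linarith only [hN₁r, hC2]
  have hN₂pos : (0 : ℝ) < N₂ := lt_of_lt_of_le hN₁pos (by exact_mod_cast hN₁₂)
  have hlogN₂ : Real.log N₂ ≤ 2 * ((K : ℝ) * ℓ) := by
    calc Real.log N₂ ≤ Real.log (C ^ 2) := Real.log_le_log hN₂pos hN₂r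
      _ = 2 * ((K : ℝ) * ℓ) := by rw [Real.log_pow, hlogC]; push_cast; ring
  have hlogN₁ : (K : ℝ) * ℓ - Real.log 2 ≤ Real.log N₁ := by
    calc (K : ℝ) * ℓ - Real.log 2 = Real.log (C / 2) := by
          rw [Real.log_div hC0.ne' two_ne_zero, hlogC]
      _ ≤ Real.log N₁ := Real.log_le_log (by positivity) hN₁r
  have hlogN₁' : Real.log N₁ ≤ (K : ℝ) * ℓ := by
    calc Real.log N₁ ≤ Real.log C := Real.log_le_log hN₁pos hN₁le
      _ = (K : ℝ) * ℓ := hlogC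
  have h4₁ : Real.log N₁ ≤ 4 * L := by linarith only [hlogN₁', hKℓ4]
  have h8₁ : Real.log N₁ ≤ 8 * L := by linarith only [h4₁, hLpos]
  have h8₂ : Real.log N₂ ≤ 8 * L := by linarith only [hlogN₂, hKℓ4]
  -- `U = Σ_{N₁<n≤N₂} g(n)/n < 5 L · L(1)`
  obtain ⟨U, hU⟩ : ∃ U : ℝ, U = ∑ n ∈ Finset.Ioc N₁ N₂, g χ n / (n : ℝ) := ⟨_, rfl⟩
  have hU0 : 0 ≤ U := by
    rw [hU]; exact Finset.sum_nonneg fun n _ => div_nonneg (g_nonneg χ hq n) (Nat.cast_nonneg n)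
  have hUlt : U < 5 * L * (χ.LFunction 1).re := by
    obtain ⟨Y₁, hY₁2, hY₁N, hE₁⟩ := mv_error_opt hD hN₁D (by rw [← hL]; exact h8₁)
    obtain ⟨Y₂, hY₂2, hY₂N, hE₂⟩ := mv_error_opt hD hN₂D2 (by rw [← hL]; exact h8₂)
    have hmv := sum_Ioc_g_div_le χ hprim hD2 hY₁2 hY₁N hY₂2 hY₂N hN₁₂
    have herr := err_total_le hsmall hN₁D hN₂D (by rw [← hL]; exact h4₁) (by rw [← hL]; exact h8₂)
    rw [← hL] at hE₁ hE₂ herr hmv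
    -- main term `< (4L + 0.7) L(1)`, errors `≤ (L − 0.7) L(1)`
    have hmain : (χ.LFunction 1).re * (Real.log N₂ - Real.log N₁) <
        (4 * L + 0.7) * (χ.LFunction 1).re := by
      have h1 : Real.log N₂ - Real.log N₁ < 4 * L + 0.7 := by
        linarith only [hlogN₂, hlogN₁, hKℓ4, hlog2]
      nlinarith only [h1, hL1pos]
    have herr' : (L - 0.7) * (Real.pi / Real.sqrt D) ≤ (L - 0.7) * (χ.LFunction 1).re :=
      mul_le_mul_of_nonneg_left hL1 (by linarith only [hL9])
    rw [hU]
    linarith only [hmv, hE₁, hE₂, herr, herr', hmain]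
  -- the intervals `I_j = (y_j, y_j²]`, `y_j = A^{2^{m−1−j}}`, `j < m`
  obtain ⟨y, hy⟩ : ∃ y : ℕ → ℝ, y = fun j => A ^ 2 ^ (m - 1 - j) := ⟨_, rfl⟩
  have hyj : ∀ j, y j = A ^ 2 ^ (m - 1 - j) := fun j => by rw [hy]
  have hypos : ∀ j, 0 < y j := fun j => by rw [hyj]; positivity
  have hyK : ∀ j, j < m → y j ^ 2 ^ j = C := by
    intro j hj
    rw [hyj, ← pow_mul, ← pow_add, Nat.sub_add_cancel (by omega : j ≤ m - 1), hC, hK]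
  have hysq : ∀ j, j + 1 < m → y j = y (j + 1) ^ 2 := by
    intro j hj
    rw [hyj, hyj, ← pow_mul, ← pow_succ]; congr 1
    rw [show m - 1 - j = m - 1 - (j + 1) + 1 by omega]
  obtain ⟨I, hI⟩ : ∃ I : ℕ → Finset ℕ, I = fun j => (Finset.range (N₂ + 1)).filter
      (fun p : ℕ => p.Prime ∧ y j < (p : ℝ) ∧ (p : ℝ) ≤ y j ^ 2 ∧ χ (p : ZMod D) ≠ -1) := ⟨_, rfl⟩
  have hmemI : ∀ j p, p ∈ I j ↔ p < N₂ + 1 ∧ p.Prime ∧ y j < (p : ℝ) ∧ (p : ℝ) ≤ y j ^ 2 ∧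
      χ (p : ZMod D) ≠ -1 := by
    intro j p; rw [hI, Finset.mem_filter, Finset.mem_range]
  have hIprime : ∀ j, ∀ p ∈ I j, p.Prime := fun j p hp => ((hmemI j p).mp hp).2.1
  -- (i) each `σ_j^{2^j} ≤ (2^j)! U`
  have hT : ∀ j ∈ Finset.range m,
      (∑ p ∈ I j, 1 / (p : ℝ)) ^ (2 ^ j) ≤ (((2 ^ j) ! : ℕ) : ℝ) * U := by
    intro j hj
    have hjm : j < m := Finset.mem_range.mp hj
    refine (pow_sum_inv_le_factorial_mul_sum (I j) (hIprime j) (2 ^ j)).trans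
      (mul_le_mul_of_nonneg_left ?_ (by positivity))
    have hS : ∀ n ∈ (Fintype.piFinset fun _ : Fin (2 ^ j) => I j).image (fun f => ∏ i, f i),
        n ∈ Finset.Ioc N₁ N₂ ∧ 1 ≤ g χ n := by
      intro n hn
      obtain ⟨f, hf, rfl⟩ := Finset.mem_image.mp hn
      have hfI : ∀ i, f i ∈ I j := fun i => Fintype.mem_piFinset.mp hf i
      have hbounds := pow_lt_prod_le₃ Nat.one_le_two_pow (hypos j) (f := f) fun i =>
        ⟨((hmemI j _).mp (hfI i)).2.2.1, ((hmemI j _).mp (hfI i)).2.2.2.1⟩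
      rw [hyK j hjm, show 2 * 2 ^ j = 2 ^ j * 2 by ring, pow_mul, hyK j hjm] at hbounds
      refine ⟨Finset.mem_Ioc.mpr ⟨?_, ?_⟩, ?_⟩
      · rw [hN₁]; exact (Nat.floor_lt hC0.le).mpr hbounds.1
      · rw [hN₂]; exact Nat.le_floor hbounds.2
      · refine one_le_g_of_forall_primeFactors χ hq ?_ fun p hp => ?_
        · exact Finset.prod_ne_zero_iff.mpr fun i _ => (hIprime j _ (hfI i)).ne_zero
        · exact ((hmemI j p).mp (primeFactors_prod_subset₃ (I j) (hIprime j) hfI hp)).2.2.2.2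
    calc ∑ n ∈ (Fintype.piFinset fun _ : Fin (2 ^ j) => I j).image (fun f => ∏ i, f i),
          1 / ((n : ℕ) : ℝ)
        ≤ ∑ n ∈ (Fintype.piFinset fun _ : Fin (2 ^ j) => I j).image (fun f => ∏ i, f i),
            g χ n / ((n : ℕ) : ℝ) :=
          Finset.sum_le_sum fun n hn => div_le_div_of_nonneg_right (hS n hn).2 (Nat.cast_nonneg n)
      _ ≤ U := by
          rw [hU]
          exact Finset.sum_le_sum_of_subset_of_nonneg (fun n hn => (hS n hn).1)
            fun n _ _ => div_nonneg (g_nonneg χ hq n) (Nat.cast_nonneg n)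
  -- (ii) `α ≤ Σ_j σ_j`: the `I_j` are disjoint and cover the primes `A < p ≤ D²` with `χ(p) ≠ −1`
  have hdisj : ((Finset.range m : Finset ℕ) : Set ℕ).PairwiseDisjoint I := by
    intro j₁ hj₁ j₂ hj₂ hne
    have hj₁m : j₁ < m := Finset.mem_range.mp hj₁
    have hj₂m : j₂ < m := Finset.mem_range.mp hj₂
    have key : ∀ a b : ℕ, a < b → b < m → y b ^ 2 ≤ y a := by
      intro a b hab hbm
      rw [hyj, hyj, ← pow_mul]
      refine pow_le_pow_right₀ hA1 ?_
      calc 2 ^ (m - 1 - b) * 2 = 2 ^ (m - 1 - b + 1) := by rw [pow_succ]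
        _ ≤ 2 ^ (m - 1 - a) := Nat.pow_le_pow_right two_pos (by omega)
    rw [Function.onFun, Finset.disjoint_left]
    intro p hp₁ hp₂
    have h₁ := (hmemI j₁ p).mp hp₁
    have h₂ := (hmemI j₂ p).mp hp₂
    rcases lt_or_gt_of_ne hne with hlt | hlt
    · have := key j₁ j₂ hlt hj₂m; linarith only [this, h₁.2.2.1, h₂.2.2.2.1]
    · have := key j₂ j₁ hlt hj₁m; linarith only [this, h₂.2.2.1, h₁.2.2.2.1]
  have hcover : (Finset.range (D ^ 2 + 1)).filter
      (fun p : ℕ => p.Prime ∧ A < (p : ℝ) ∧ χ (p : ZMod D) ≠ -1) ⊆ (Finset.range m).biUnion I := by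
    intro p hp
    rw [Finset.mem_filter, Finset.mem_range] at hp
    obtain ⟨hpD, hpp, hAp, hχp⟩ := hp
    have hpN₂ : p < N₂ + 1 := by
      have : p ≤ D ^ 4 := by
        calc p ≤ D ^ 2 := by omega
          _ ≤ D ^ 4 := Nat.pow_le_pow_right (by omega) (by norm_num)
      omega
    have hex : ∃ j, j < m ∧ y j < (p : ℝ) := ⟨m - 1, by omega, by
      rw [hyj, show m - 1 - (m - 1) = 0 by omega, pow_zero, pow_one]; exact hAp⟩
    obtain ⟨j₀, hj₀⟩ : ∃ j₀, j₀ = Nat.find hex := ⟨_, rfl⟩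
    have hj₀spec := Nat.find_spec hex
    rw [← hj₀] at hj₀spec
    rw [Finset.mem_biUnion]
    refine ⟨j₀, Finset.mem_range.mpr hj₀spec.1, (hmemI j₀ p).mpr ⟨hpN₂, hpp, hj₀spec.2, ?_, hχp⟩⟩
    rcases Nat.eq_zero_or_pos j₀ with hz | hpos
    · -- `j₀ = 0`: `p ≤ D² ≤ C ≤ C² = y₀²`
      rw [hz, show y 0 ^ 2 = C ^ 2 by
        rw [← hyK 0 (by omega), pow_zero, pow_one]]
      have : (p : ℝ) ≤ (D : ℝ) ^ 2 := by
        have h' : p ≤ D ^ 2 := by omega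
        exact_mod_cast h'
      linarith only [this, hCD2, hCC]
    · -- `j₀ = j' + 1`: minimality gives `p ≤ y_{j'} = y_{j₀}²`
      have hmin := Nat.find_min hex (show j₀ - 1 < Nat.find hex by rw [← hj₀]; omega)
      push Not at hmin
      have hle := hmin (by omega)
      rw [show y j₀ ^ 2 = y (j₀ - 1) by
        rw [hysq (j₀ - 1) (by omega), show j₀ - 1 + 1 = j₀ by omega]]
      exact hle
  have hsum : α ≤ ∑ j ∈ Finset.range m, ∑ p ∈ I j, 1 / (p : ℝ) := by
    rw [← Finset.sum_biUnion hdisj, hα]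
    exact Finset.sum_le_sum_of_subset_of_nonneg hcover fun p _ _ => by positivity
  -- conclude by the selection inequality
  have hsel := rpow_div_le_of_pow_le_factorial_mul hm1 (σ := fun j => ∑ p ∈ I j, 1 / (p : ℝ))
    hα0 hαM hMm hU0 hsum (fun j hj => by exact_mod_cast hT j hj)
  have h5L : 0 < 5 * L := by positivity
  calc 1 / (5 * L) * (α / M) ^ M ≤ 1 / (5 * L) * U :=
        mul_le_mul_of_nonneg_left hsel (by positivity)
    _ < 1 / (5 * L) * (5 * L * (χ.LFunction 1).re) := mul_lt_mul_of_pos_left hUlt (by positivity)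
    _ = (χ.LFunction 1).re := by field_simp

end LemmaThree

end Pintz1976

/-- **Pintz 1976 (II), Lemma 3 — PROVED** (`pintz1976_lemma3_holds : pintz1976_lemma3`): for
`D ≥ 1500`, a real primitive `χ` mod `D`, `2 ≤ A ≤ D²` and `α = Σ_{A<p≤D², χ(p)≠−1} 1/p`,
`L(1, χ) > (1/(5 log D))(α log A/(8 log D))^{8 log D/log A}`, with the printed constants. Road as
printed (§5 pp. 286–287) on the sibling files' engines, the Lemma-1 input replaced by
Montgomery–Vaughan 11.2.3(g) with an optimised cut (`Pintz1976.lemma3`).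
[cite: Pintz1976ElementaryII, Lemma 3 p. 286 (5.1)–(5.2)] -/
theorem pintz1976_lemma3_holds : pintz1976_lemma3 := Pintz1976.lemma3

end Literature.NumberTheory.LFunctions

end
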